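import Summits.BirchSwinnertonDyer.Rank1Residual.X11b.BDPRouteLocalKernelInertia
import Literature.NumberTheory.EllipticCurves.IwasawaSelmerControlAwayFromPProofs
import Literature.NumberTheory.EllipticCurves.InertiaInvariantsKodairaNeronAdditiveProofs
import Literature.NumberTheory.EllipticCurves.TamagawaSubgroupProofs
import Literature.NumberTheory.EllipticCurves.TamagawaFiniteIndexProofs
import HarnessLib

/-!
# Class X11b, route p2: local bridges for the subgroup of non-singular reduction —
# `c_v` as an index of `E₀` on the minimal model, `E₀` over `𝓞_v` versus `E₀` over `\bar 𝓞_v` for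
# `K_v`-rational points, Galois descent `X(K̄_v)^{Γ_{K_v}} = X(K_v)`, and the prime `𝔓₀`
# (cell `b2b-bsdres`, sub-cell `multr1-p2`, gen 14)

HONEST FRAMING (verbatim, cell `b2b-bsdres`): the goal of the cell is to DELETE the
COMBINATION-SHAPED residual classes for ALL analytic-rank `≤ 1` curves over `ℚ` — "full BSD
formula for every rank `≤ 1` curve in class `C`" assembled STRICTLY from published theorems — so
that the rank-`≤ 1` remainder becomes exactly the CONSTRUCTION-SHAPED classes, which are TYPED
(missing-input Props), NOT attempted; this is not "finishing BSD". Research route `p2` for class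
X11b; no claim beyond the stated class; nothing booked; X11b stays CONSTRUCTION-SHAPED. Theorems
only; no definition, no named fact, no `sorry`.

## Why this file

`BDPRouteLocalKernelInertia(Bound)` (this generation) reduce Greenberg's bad-place bound
`#ker r_v ≤ c_v^{(p)}` (Lemma 3.3, LNM 1716 p. 87; proof of Thm. 4.1) to a `φ`-stable finite-index
subgroup `M₀ ≤ E(K̄)^{I_v}` with divisible `M₀[p^∞]` and `[E(K̄)^{D_v} : E(K̄)^{D_v} ⊓ M₀] ∣ c_v`.
The intended `M₀` is the set of `I_v`-fixed points whose image in `X(K̄_v)` — `X` the minimal model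
at `v`, along the chosen embedding `K̄ → K̄_v` — has non-singular reduction for the spectral
valuation. This file supplies the purely LOCAL identifications needed to compare that `E₀` with the
tree's Tamagawa number `c_v = [X(K_v) : X₀(K_v)]` (`Tamagawa.lean`, computed over `𝓞_v`):

* `primeBelow_closureEmb_eq_adicCompletionPrime` — for every prime `𝔐` of `\bar 𝓞_v` above `𝓂_v`,
  the prime `𝔓_{ι,𝔐}` of `\bar ℤ_K` cut out by the tree's embedding `ι = closureEmb K_v` IS the
  prime `𝔓₀ = adicCompletionPrime K v` of `GreenbergSelmer.decomp` (both are `{|ι ·|_v < 1}`);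
  `resGalOfEmb_closureEmb_mem_decomp`, `exists_eq_resGalOfEmb_of_mem_decomp` — `D_v` is the image
  of `Γ_{K_v}` under the restriction along `ι`.
* `localTamagawaNumber_eq_index_nonsingularReductionSubgroup` — `c_v(E/K)` is the index in `X(K_v)`
  of the subgroup of points with non-singular reduction of the minimal `𝓞_v`-model
  `M = W.localMinimalIntegralModel v` (`ReductionHomomorphism.nonsingularReductionSubgroup`;
  tree `goodReductionSubgroup_baseChange_eq`).
* `hasNonsingularReduction_algebraMap_iff` — **`E₀` is compatible with passing to `K̄_v`**: a
  `K_v`-rational point of `X` has non-singular reduction for `M` over `𝓞_v` iff its image in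
  `X(K̄_v)` has non-singular reduction for any `𝒪_w`-model `W₀` of `X ⊗ K̄_v`, `w = |·|_v` the
  spectral valuation (`𝓞_v → 𝒪_w` is a local homomorphism inducing an injection of residue fields;
  nonsingularity is invariant under it, Mathlib `Affine.map_nonsingular`).
* `exists_point_map_eq_of_forall_map_eq` — **Galois descent** `X(K̄_v)^{Γ_{K_v}} ⊆ X(K_v)` for any
  Weierstrass equation over `K_v` (coordinates fixed by `Γ_{K_v}` lie in `K_v`,
  `mem_adjoin_of_forall_smul_eq`; as in `finite_setOf_forall_map_eq_and_nsmul_eq_zero`).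

References: [SilvermanAEC2009] VII.§2 (`E₀`, `E₁`, Prop. VII.2.1), §VII.6 (`c_v`), VIII.§1 (Galois
descent for points); [NeukirchANT1999] II (4.8), (8.1)–(8.2), §9 (9.6); [GreenbergLNM1716] §3
Lemma 3.3 (p. 87), proof of Thm. 4.1 (p. 74: "`ker r_v` has order `c_v^{(p)}`").
-/

noncomputable section

open scoped Classical NNReal

open NumberField IsDedekindDomain Field IsDedekindDomain.HeightOneSpectrum
open Literature.NumberTheory.EllipticCurves Literature.NumberTheory.EllipticCurves.GreenbergSelmer
open Literature.NumberTheory.GaloisRepresentations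

universe u

namespace Summit.BirchSwinnertonDyer.Rank1Residual.X11b.AcSelmer

variable {K : Type u} [Field K] [NumberField K]

/-! ## The prime `𝔓₀` and the decomposition group of the chosen embedding -/

section Prime

variable (v : HeightOneSpectrum (𝓞 K))

/-- **`𝔓_{ι,𝔐} = 𝔓₀`**: for every prime `𝔐` of `\bar 𝓞_v` above `𝓂_v`, the prime of `\bar ℤ_K` cut
out by the chosen embedding `ι = closureEmb K_v : K̄ → K̄_v` and `𝔐` is the prime
`adicCompletionPrime K v` whose decomposition group is `GreenbergSelmer.decomp v` — both are
`{s : |ι s|_v < 1}` (`mem_iff_spectralValuation_lt_one`, `mem_adicCompletionPrime_iff`; the two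
chosen embeddings of the tree are the same `IsAlgClosed.lift`). [cite: NeukirchANT1999, Ch. II (8.1)–(8.2)] -/
theorem primeBelow_closureEmb_eq_adicCompletionPrime {𝔐 : Ideal v.localAbsIntegers}
    (h𝔐 : 𝔐 ∈ v.localPrimesAbove) :
    v.primeBelow (closureEmb (K := K) (v.adicCompletion K)) 𝔐 = adicCompletionPrime K v := by
  obtain ⟨w, hw⟩ := v.exists_spectralValuation
  ext s
  rw [mem_primeBelow_iff, mem_iff_spectralValuation_lt_one hw h𝔐, mem_adicCompletionPrime_iff,
    coe_absIntegersToLocal_apply, ← NNReal.coe_lt_coe, hw, NNReal.coe_one]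
  rfl

/-- `res_ι σ ∈ D_v` for every `σ ∈ Γ_{K_v}`, `ι = closureEmb K_v` (`decomp v` is the image of the
restriction map; `resGal_eq`, `resGal_eq_absGaloisRestrict`). [cite: NeukirchANT1999, Ch. II §9 Prop. (9.6)] -/
theorem resGalOfEmb_closureEmb_mem_decomp (σ : absoluteGaloisGroup (v.adicCompletion K)) :
    resGalOfEmb (closureEmb (K := K) (v.adicCompletion K)) σ ∈ decomp v := by
  rw [← resGal_eq]
  exact (mem_decomp_iff v _).mpr ⟨σ, rfl⟩

/-- Every element of `D_v` is `res_ι σ` for some `σ ∈ Γ_{K_v}`. [cite: NeukirchANT1999, Ch. II §9 Prop. (9.6)] -/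
theorem exists_eq_resGalOfEmb_of_mem_decomp {g : absoluteGaloisGroup K} (hg : g ∈ decomp v) :
    ∃ σ : absoluteGaloisGroup (v.adicCompletion K),
      resGalOfEmb (closureEmb (K := K) (v.adicCompletion K)) σ = g := by
  obtain ⟨σ, rfl⟩ := (mem_decomp_iff v g).mp hg
  exact ⟨σ, by rw [← resGal_eq]; rfl⟩

end Prime

/-! ## `c_v` as the index of the subgroup of non-singular reduction of the minimal `𝓞_v`-model -/

section Index

variable (W : WeierstrassCurve K) (v : HeightOneSpectrum (𝓞 K))

/-- **`c_v(E/K) = [X(K_v) : X₀(K_v)]` on the minimal `𝓞_v`-model `M = W.localMinimalIntegralModel v`**,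
with `X₀(K_v)` the subgroup of points with non-singular reduction of `ReductionHomomorphism`
(`nonsingularReductionSubgroup`, membership `M.HasNonsingularReduction`): the tree's
`localTamagawaNumber` is by definition the index of `goodReductionSubgroup` on `W.localMinimalModel v`,
which is `M ⊗ K_v` (`map_localMinimalIntegralModel_eq`), and the two `E₀`'s agree
(`goodReductionSubgroup_baseChange_eq`, Silverman *AEC* VII.2.1).
[cite: SilvermanAEC2009, §VII.6 (Ex. 7.6: `c_v = [E(K_v) : E₀(K_v)]`) and VII.2 Prop. 2.1] -/
theorem localTamagawaNumber_eq_index_nonsingularReductionSubgroup :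
    (W.baseChange (v.adicCompletion K)).localTamagawaNumber (v.adicCompletionIntegers K) =
      ((W.localMinimalIntegralModel v).nonsingularReductionSubgroup
        (integers_valuationRing_valuation (v.adicCompletionIntegers K) (v.adicCompletion K))).index := by
  rw [WeierstrassCurve.localTamagawaNumber_baseChange_eq]
  haveI : ((W.localMinimalIntegralModel v).baseChange (v.adicCompletion K)).IsMinimal
      (v.adicCompletionIntegers K) := W.isMinimal_map_localMinimalIntegralModel (v := v)
  have key : ∀ (Y : WeierstrassCurve (v.adicCompletion K))
      [Y.IsMinimal (v.adicCompletionIntegers K)], Y = W.localMinimalModel v →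
      (Y.goodReductionSubgroup (v.adicCompletionIntegers K)).index =
        ((W.localMinimalModel v).goodReductionSubgroup (v.adicCompletionIntegers K)).index := by
    rintro Y _ rfl; rfl
  rw [← key ((W.localMinimalIntegralModel v).baseChange (v.adicCompletion K))
    (W.map_localMinimalIntegralModel_eq (v := v)),
    WeierstrassCurve.goodReductionSubgroup_baseChange_eq]

/-- `c_v ≠ 0`: the subgroup of non-singular reduction of the minimal model has finite index in
`X(K_v)` (tree `localTamagawaNumber_baseChange_ne_zero`, Silverman *AEC* Cor. VII.6.2 / Ex. 7.6).
[cite: SilvermanAEC2009, Cor. VII.6.2] -/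
theorem finiteIndex_nonsingularReductionSubgroup_localMinimalIntegralModel [W.IsElliptic] :
    ((W.localMinimalIntegralModel v).nonsingularReductionSubgroup
        (integers_valuationRing_valuation (v.adicCompletionIntegers K)
          (v.adicCompletion K))).FiniteIndex := by
  refine ⟨?_⟩
  rw [← localTamagawaNumber_eq_index_nonsingularReductionSubgroup]
  exact W.localTamagawaNumber_baseChange_ne_zero v

end Index

/-! ## `E₀` over `𝓞_v` versus `E₀` over `𝒪_w ⊆ K̄_v` for `K_v`-rational points -/

section Bridge

variable {v : HeightOneSpectrum (𝓞 K)}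
  {w : Valuation (AlgebraicClosure (v.adicCompletion K)) ℝ≥0}
  (hw : ∀ x, (w x : ℝ) = spectralNorm (v.adicCompletion K) (AlgebraicClosure (v.adicCompletion K)) x)
include hw

/-- **`E₀` is compatible with passing from `K_v` to `K̄_v`.** Let `M` be a Weierstrass equation
over `𝓞_v`, `X = M ⊗ K_v`, `w = |·|_v` the spectral valuation on `K̄_v` with valuation ring `𝒪_w`,
and `W₀` an `𝒪_w`-equation with `X ⊗ K̄_v = W₀ ⊗ K̄_v`. For a `K_v`-rational affine point `(x₀, y₀)`
of `X`: its image `(x₀, y₀) ∈ X(K̄_v) = W₀(K̄_v)` has non-singular reduction for `W₀` (over `𝒪_w`)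
iff `(x₀, y₀)` has non-singular reduction for `M` (over `𝓞_v`). Indeed `W₀ = M ⊗_{𝓞_v} 𝒪_w`
(coefficients: `𝒪_w → K̄_v` is injective), `x₀ ∈ 𝓞_v ↔ |x₀|_v ≤ 1`, `𝓞_v → 𝒪_w` is a local
homomorphism, so the reduced equation of `W₀` is the reduced equation of `M` pushed along the
(injective) map of residue fields `k_v → k_w`, under which nonsingularity of `(x̄₀, ȳ₀)` is invariant
(Mathlib `Affine.map_nonsingular`). Silverman *AEC* VII.2 (the definition of `E₀` depends only on the
reduced point). [cite: SilvermanAEC2009, VII.§2 (definition of `E₀(K)`, PDF p. 167) and Prop. VII.5.4(a) (unramified base change)] -/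
theorem hasNonsingularReduction_algebraMap_iff (M : WeierstrassCurve (v.adicCompletionIntegers K))
    {𝔐 : Ideal v.localAbsIntegers} (h𝔐 : 𝔐 ∈ v.localPrimesAbove)
    {W₀ : WeierstrassCurve w.integer}
    (hW₀ : (M.map (algebraMap (v.adicCompletionIntegers K) (v.adicCompletion K))).baseChange
        (AlgebraicClosure (v.adicCompletion K)) =
      W₀.baseChange (AlgebraicClosure (v.adicCompletion K)))
    {x₀ y₀ : v.adicCompletion K}
    (h : (M.map (algebraMap (v.adicCompletionIntegers K) (v.adicCompletion K))).toAffine.Nonsingular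
      x₀ y₀)
    (h' : (W₀.baseChange (AlgebraicClosure (v.adicCompletion K))).toAffine.Nonsingular
      (algebraMap (v.adicCompletion K) (AlgebraicClosure (v.adicCompletion K)) x₀)
      (algebraMap (v.adicCompletion K) (AlgebraicClosure (v.adicCompletion K)) y₀)) :
    W₀.HasNonsingularReduction (.some _ _ h') ↔ M.HasNonsingularReduction (.some x₀ y₀ h) := by
  -- notation and the two valuation rings
  have hv0 : w.Integers w.integer := Valuation.integer.integers w
  have hv₀ : (Valued.v : Valuation (v.adicCompletion K) (WithZero (Multiplicative ℤ))).Integers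
      (v.adicCompletionIntegers K) := Valuation.valuationSubring.integers _
  have hle : ∀ a : v.adicCompletionIntegers K,
      w (algebraMap (v.adicCompletion K) (AlgebraicClosure (v.adicCompletion K))
        (algebraMap (v.adicCompletionIntegers K) (v.adicCompletion K) a)) ≤ 1 :=
    fun a ↦ (spectralValuation_algebraMap_le_one_iff hw _).mpr a.2
  -- the local homomorphism `φ₀ : 𝓞_v → 𝒪_w`
  let φ₀ : v.adicCompletionIntegers K →+* w.integer :=
    ((algebraMap (v.adicCompletion K) (AlgebraicClosure (v.adicCompletion K))).comp
      (algebraMap (v.adicCompletionIntegers K) (v.adicCompletion K))).codRestrict w.integer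
      fun a ↦ (Valuation.mem_integer_iff w _).mpr (hle a)
  have hφ₀ : ∀ a : v.adicCompletionIntegers K, ((φ₀ a : w.integer) :
      AlgebraicClosure (v.adicCompletion K)) =
        algebraMap (v.adicCompletion K) (AlgebraicClosure (v.adicCompletion K))
          (algebraMap (v.adicCompletionIntegers K) (v.adicCompletion K) a) := fun _ ↦ rfl
  haveI : IsLocalHom φ₀ := by
    refine ⟨fun a ha ↦ ?_⟩
    by_contra hna
    have hmem : a ∈ IsLocalRing.maximalIdeal (v.adicCompletionIntegers K) := hna
    have hlt := WeierstrassCurve.spectralValuation_algebraMap_lt_one_of_mem_maximalIdeal hw h𝔐 hmem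
    rw [← hφ₀] at hlt
    have h1 : w ((φ₀ a : w.integer) : AlgebraicClosure (v.adicCompletion K)) = 1 :=
      (Valuation.Integers.isUnit_iff_valuation_eq_one hv0).mp ha
    exact (lt_irrefl (1 : ℝ≥0)) (h1 ▸ hlt)
  -- `W₀ = M ⊗ 𝒪_w`
  have hW₀' : W₀ = M.map φ₀ := by
    refine WeierstrassCurve.map_injective (f := algebraMap w.integer (AlgebraicClosure
      (v.adicCompletion K))) Subtype.val_injective ?_
    change W₀.baseChange (AlgebraicClosure (v.adicCompletion K)) =
      (M.map φ₀).map (algebraMap w.integer (AlgebraicClosure (v.adicCompletion K)))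
    rw [← hW₀, WeierstrassCurve.map_map]
    rfl
  -- the map of residue fields and the reduced equations
  set kmap := IsLocalRing.ResidueField.map φ₀ with hkmap
  have hred : W₀.map (IsLocalRing.residue w.integer) =
      (M.map (IsLocalRing.residue (v.adicCompletionIntegers K))).map kmap := by
    rw [hW₀', WeierstrassCurve.map_map, WeierstrassCurve.map_map]
    congr 1
  -- case distinction on `|x₀|_v`
  by_cases hx : x₀ ∈ v.adicCompletionIntegers K
  · -- integral point: `x₀ = a`, `y₀ = b` with `a, b ∈ 𝓞_v`
    obtain ⟨a, rfl⟩ : ∃ a : v.adicCompletionIntegers K,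
        algebraMap (v.adicCompletionIntegers K) (v.adicCompletion K) a = x₀ := ⟨⟨x₀, hx⟩, rfl⟩
    have hy : Valued.v y₀ ≤ 1 :=
      v_Y_le_one_of_v_X_le_one (W := M) hv₀ h.1 (hv₀.map_le_one a)
    obtain ⟨b, rfl⟩ : ∃ b : v.adicCompletionIntegers K,
        algebraMap (v.adicCompletionIntegers K) (v.adicCompletion K) b = y₀ :=
      (exists_algebraMap_eq_iff hv₀).mpr hy
    rw [WeierstrassCurve.hasNonsingularReduction_some_algebraMap_iff
      (IsFractionRing.injective (v.adicCompletionIntegers K) (v.adicCompletion K)) h]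
    have h'' : (W₀.baseChange (AlgebraicClosure (v.adicCompletion K))).toAffine.Nonsingular
        (algebraMap w.integer (AlgebraicClosure (v.adicCompletion K)) (φ₀ a))
        (algebraMap w.integer (AlgebraicClosure (v.adicCompletion K)) (φ₀ b)) := h'
    change W₀.HasNonsingularReduction (.some _ _ h'') ↔ _
    rw [WeierstrassCurve.hasNonsingularReduction_some_algebraMap_iff Subtype.val_injective h'', hred,
      hkmap, ← IsLocalRing.ResidueField.map_residue, ← IsLocalRing.ResidueField.map_residue]
    exact WeierstrassCurve.Affine.map_nonsingular _ (RingHom.injective _) _ _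
  · -- non-integral point: both reduce to the origin
    have hx' : algebraMap (v.adicCompletion K) (AlgebraicClosure (v.adicCompletion K)) x₀ ∉
        Set.range (algebraMap w.integer (AlgebraicClosure (v.adicCompletion K))) := by
      rw [not_mem_range_iff hv0, ← not_le, spectralValuation_algebraMap_le_one_iff hw]
      exact hx
    have hx₀ : x₀ ∉ Set.range (algebraMap (v.adicCompletionIntegers K) (v.adicCompletion K)) := by
      rintro ⟨a, rfl⟩; exact hx a.2
    exact iff_of_true (Or.inl hx') (Or.inl hx₀)

end Bridge

/-! ## Galois descent `X(K̄_v)^{Γ_{K_v}} ⊆ X(K_v)` -/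

section Descent

variable {v : HeightOneSpectrum (𝓞 K)}

/-- **Galois descent for points of a Weierstrass equation over `K_v`.** A point of `X(K̄_v)` fixed
by every `σ ∈ Γ_{K_v}` is the image of a (unique) `K_v`-rational point of `X` under
`X(K_v) = (X ⊗ K_v)(K_v) → X(K̄_v)` (its coordinates are fixed by `Gal(K̄_v/K_v)`, hence lie in `K_v`:
`mem_adjoin_of_forall_smul_eq`; nonsingularity descends along the injection `K_v → K̄_v`,
Mathlib `Affine.map_nonsingular`). Silverman *AEC* I.§1, VIII.§1.
[cite: SilvermanAEC2009, I.§1 and VIII.§1 (proof of Prop. 1.2)] -/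
theorem exists_point_map_eq_of_forall_map_eq (X : WeierstrassCurve (v.adicCompletion K))
    {Q : (X.baseChange (AlgebraicClosure (v.adicCompletion K))).toAffine.Point}
    (hQ : ∀ σ : absoluteGaloisGroup (v.adicCompletion K),
      WeierstrassCurve.Affine.Point.map ((absoluteGaloisGroup.toAlgEquiv _ σ :
          AlgebraicClosure (v.adicCompletion K) ≃ₐ[v.adicCompletion K]
            AlgebraicClosure (v.adicCompletion K)) :
          AlgebraicClosure (v.adicCompletion K) →ₐ[v.adicCompletion K]
            AlgebraicClosure (v.adicCompletion K)) Q = Q) :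
    ∃ R : (X.baseChange (v.adicCompletion K)).toAffine.Point,
      WeierstrassCurve.Affine.Point.map (W' := X)
        (Algebra.ofId (v.adicCompletion K) (AlgebraicClosure (v.adicCompletion K))) R = Q := by
  -- Galois descent of coordinates
  have hdesc : ∀ z : AlgebraicClosure (v.adicCompletion K),
      (∀ σ : absoluteGaloisGroup (v.adicCompletion K),
        (absoluteGaloisGroup.toAlgEquiv (v.adicCompletion K)) σ z = z) →
      ∃ z₀ : v.adicCompletion K,
        algebraMap (v.adicCompletion K) (AlgebraicClosure (v.adicCompletion K)) z₀ = z := by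
    intro z hz
    have h1 : z ∈ IntermediateField.adjoin (v.adicCompletion K)
        {(1 : AlgebraicClosure (v.adicCompletion K))} :=
      mem_adjoin_of_forall_smul_eq (v := v) fun σ _ ↦ hz σ
    rw [IntermediateField.adjoin_simple_eq_bot_iff.mpr (one_mem _), IntermediateField.mem_bot] at h1
    exact h1
  rcases Q with _ | ⟨x, y, h⟩
  · exact ⟨0, map_zero _⟩
  · have hxy : ∀ σ : absoluteGaloisGroup (v.adicCompletion K),
        (absoluteGaloisGroup.toAlgEquiv (v.adicCompletion K)) σ x = x ∧
          (absoluteGaloisGroup.toAlgEquiv (v.adicCompletion K)) σ y = y := by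
      intro σ
      have := hQ σ
      rw [WeierstrassCurve.Affine.Point.map_some] at this
      simpa [WeierstrassCurve.Affine.Point.some.injEq] using this
    obtain ⟨x₀, rfl⟩ := hdesc x fun σ ↦ (hxy σ).1
    obtain ⟨y₀, rfl⟩ := hdesc y fun σ ↦ (hxy σ).2
    have h₀ : (X.baseChange (v.adicCompletion K)).toAffine.Nonsingular x₀ y₀ := by
      have e : X.baseChange (v.adicCompletion K) = X := by
        change X.map (algebraMap (v.adicCompletion K) (v.adicCompletion K)) = X
        rw [Algebra.algebraMap_self, WeierstrassCurve.map_id]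
      rw [e]
      exact (WeierstrassCurve.Affine.map_nonsingular X.toAffine
        (FaithfulSMul.algebraMap_injective (v.adicCompletion K)
          (AlgebraicClosure (v.adicCompletion K))) x₀ y₀).mp h
    refine ⟨.some x₀ y₀ h₀, ?_⟩
    rw [WeierstrassCurve.Affine.Point.map_some]
    rfl

end Descent

end Summit.BirchSwinnertonDyer.Rank1Residual.X11b.AcSelmer

end
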